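import Summits.NavierStokesRegularity.NavierStokesRegularity.Theorems.RecurrentProfilesRecurrentLiouvilleFrCore
import Summits.NavierStokesRegularity.NavierStokesRegularity.Theorems.RecurrentProfilesRecurrentLiouvilleFrOrbitModulus
import Literature.Analysis.FluidPDE.SelfSimilar
import HarnessLib

/-!
# Crux `RecurrentLiouville` (stmt-NavierStokesRegularity-1589), line `Sketch` v7 — stub S4
# `stub_frFastRecurrenceRemoval`: FAST RECURRENCE REMOVAL in the Albritton–Barker class (lead c9)

Theorems-only file (no definitions, no named facts).  The class: suitable weak solutions `(u, p)` of
Navier–Stokes (`ν = 1`, `f = 0`) on the backward slab `ℝ³ × ℝ₋` with weak gradient `G`,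
Albritton–Barker quantity `𝐈 ≤ M` and the Type-I rate `‖u(t,x)‖ ≤ C/√(−t)`; the scaling orbit
`σ ↦ u_{e^σ}`, `u_c(t,x) = c u(c²t, cx)`; "regular" = `¬ IsBackwardSingularPoint u 0`.

* `stub_frFastRecurrenceRemoval` (registered stub S4 of skeleton v7) — **fast recurrence removal**:
  `∃ L(C,M) > 0, δ(C,M) > 0` such that a class member whose scaling orbit returns `δ`-close to it in
  `L³(Q(0,1))` within EVERY log-scale window `[a, a + L]` is regular at the origin.  It is the landed
  core `frCore_fast_of_modulus` (p147803: return + class-uniform modulus of the returned orbit point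
  put the whole orbit in the `δ_SHR`-ball; `smallHullRemoval`, p117043) fed with the landed
  class-uniform orbit modulus `stub_frOrbitModulus` (A–B compactness + orbit continuity).
  In the language of the crux: the crux grants, for every `ε` and compact `K ⊆ {t ≤ 0} × ℝ³`, a
  return length `L(ε, K)`; the rung settles every profile with `L(δ(C,𝐈), [-1,0] × B̄₁) ≤ L(C,𝐈)`
  (`fr_fastRecurrenceRemoval_compact`).  It contains the near-identity `λ`-DSS rung (periodic orbits,
  `L = log λ`; Chae–Wolf 2017 Thm 1.3 — the tree's `stub_rlNearIdentityDSS`, p118437: an a.e. `λ`-DSS orbit returns EXACTLY at the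
  log-scales `n log λ`, `n ∈ ℤ`, so for `log λ ≤ L` its return gaps are `≤ L`)
  and extends it to Bohr-almost-periodic orbits (uniform `δ`-almost periods with inclusion length
  `≤ L` are in particular `δ`-returns of the base point) and to quasi-periodic hulls with any number
  of incommensurable log-frequencies, all large ("no FAST quasi-breathers": card
  `Ideas/rung-neighbourhoods.md`, Branch B, in metric form — no almost-periodicity definition needed).
* `fr_slowRecurrence_of_singular` — the portrait clause: a Type-I singularity model recurs SLOWLY
  (some window `[a, a + L(C,𝐈)]` without `δ(C,𝐈)`-returns); with `gk_orbitNeverRests` (p142905) the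
  orbit of a counterexample neither slows down nor returns fast.

## References

* D. Chae, J. Wolf, arXiv:1610.09464, Thm 1.3. [ChaeWolf2017RemovingDSS]
* T.-P. Tsai, Arch. Rational Mech. Anal. 143 (1998), Thm 1. [Tsai1998]
* D. Albritton, T. Barker, J. Math. Fluid Mech. 21 (2019), Lemma 2.2, Prop. 2.3, §3. [AlbrittonBarker2019]
* H. Bohr, *Almost Periodic Functions* (1947), §§44–46 (almost periods, inclusion length). [folklore]
-/

noncomputable section

-- the sub-problem namespace repeats the summit name (D-0017 layout `Summit.<S>.<P>.Theorems`)
set_option linter.dupNamespace false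

namespace Summit.NavierStokesRegularity.NavierStokesRegularity.Theorems

open MeasureTheory Set Function Filter Topology TopologicalSpace Metric
open Literature.Analysis Literature.Analysis.FluidPDE
open scoped NNReal ENNReal

/-! ### The registered stub S4 -/

/-- **S4 — fast recurrence removal** (registered stub `stub_frFastRecurrenceRemoval` of crux
stmt-NavierStokesRegularity-1589, line Sketch v7).  For every rate `C` and bound `M < ⊤` there are
`L > 0`, `δ > 0` such that a class member (suitable weak on `ℝ³ × ℝ₋`, weak gradient, `𝐈 ≤ M`,
rate `C`) whose scaling orbit returns `δ`-close to it in `L³(Q(0,1))` in EVERY log-scale window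
`[a, a + L]` is regular at the origin: `frCore_fast_of_modulus` (p147803) fed with the class-uniform
orbit modulus `stub_frOrbitModulus`.
[cite: ChaeWolf2017RemovingDSS, Thm 1.3; Tsai1998, Thm 1; AlbrittonBarker2019, Lemma 2.2, Prop. 2.3] -/
theorem stub_frFastRecurrenceRemoval :
    ∀ (C : ℝ) (M : ℝ≥0∞), M < ⊤ → ∃ L : ℝ, 0 < L ∧ ∃ δ : ℝ, 0 < δ ∧
      ∀ (u : ℝ → EuclideanSpace ℝ (Fin 3) → EuclideanSpace ℝ (Fin 3))
        (p : ℝ → EuclideanSpace ℝ (Fin 3) → ℝ)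
        (G : ℝ → EuclideanSpace ℝ (Fin 3) → EuclideanSpace ℝ (Fin 3) →L[ℝ] EuclideanSpace ℝ (Fin 3)),
        IsSuitableWeakSolutionOn (slab (EuclideanSpace ℝ (Fin 3)) (Iio 0) isOpen_Iio) 1 0 u p →
        HasWeakSpatialGradientOn (slab (EuclideanSpace ℝ (Fin 3)) (Iio 0) isOpen_Iio) u G →
        typeIBound (Iio (0 : ℝ) ×ˢ univ) u p G ≤ M →
        HasTypeITimeDecay C u →
        (∀ a : ℝ, ∃ σ ∈ Icc a (a + L),
          eLpNorm (uncurry (nsRescale (Real.exp σ) u) - uncurry u) 3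
            (volume.restrict (parabolicCylinder 1 (0 : ℝ × EuclideanSpace ℝ (Fin 3)))) ≤
              ENNReal.ofReal δ) →
        ¬ IsBackwardSingularPoint u 0 :=
  frCore_fast_of_modulus stub_frOrbitModulus

/-! ### In the crux's own vocabulary; the portrait clause -/

/-- The compact box `[-1, 0] × B̄₁` is compact and lies in the closed lower half-space. [folklore] -/
theorem frHarvest_box_isCompact :
    IsCompact (Icc (-1 : ℝ) 0 ×ˢ closedBall (0 : EuclideanSpace ℝ (Fin 3)) 1) ∧
      Icc (-1 : ℝ) 0 ×ˢ closedBall (0 : EuclideanSpace ℝ (Fin 3)) 1 ⊆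
        Iic (0 : ℝ) ×ˢ (univ : Set (EuclideanSpace ℝ (Fin 3))) :=
  ⟨isCompact_Icc.prod (isCompact_closedBall _ _),
    prod_mono (fun _ ht => ht.2) (subset_univ _)⟩

/-- **Fast recurrence removal, stated in the crux's recurrence clause.**  For every rate `C` and
bound `M < ⊤` there are `L > 0`, `δ > 0` such that a class member whose scaling orbit returns
`δ`-close to it in `L³([-1,0] × B̄₁)` (the compact set of the crux's hypothesis) within every
log-scale window `[a, a + L]` is regular at the origin — i.e. if the crux's recurrence function
`L(ε, K)` satisfies `L(δ, [-1,0] × B̄₁) ≤ L(C, 𝐈)`, the conclusion of the crux holds.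
[cite: Tsai1998, Thm 1; AlbrittonBarker2019, Lemma 2.2, Prop. 2.3] -/
theorem fr_fastRecurrenceRemoval_compact :
    ∀ (C : ℝ) (M : ℝ≥0∞), M < ⊤ → ∃ L : ℝ, 0 < L ∧ ∃ δ : ℝ, 0 < δ ∧
      ∀ (u : ℝ → EuclideanSpace ℝ (Fin 3) → EuclideanSpace ℝ (Fin 3))
        (p : ℝ → EuclideanSpace ℝ (Fin 3) → ℝ)
        (G : ℝ → EuclideanSpace ℝ (Fin 3) → EuclideanSpace ℝ (Fin 3) →L[ℝ] EuclideanSpace ℝ (Fin 3)),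
        IsSuitableWeakSolutionOn (slab (EuclideanSpace ℝ (Fin 3)) (Iio 0) isOpen_Iio) 1 0 u p →
        HasWeakSpatialGradientOn (slab (EuclideanSpace ℝ (Fin 3)) (Iio 0) isOpen_Iio) u G →
        typeIBound (Iio (0 : ℝ) ×ˢ univ) u p G ≤ M →
        HasTypeITimeDecay C u →
        (∀ a : ℝ, ∃ σ ∈ Icc a (a + L),
          eLpNorm (fun z : ℝ × EuclideanSpace ℝ (Fin 3) => nsRescale (Real.exp σ) u z.1 z.2 - u z.1 z.2) 3
            (volume.restrict (Icc (-1 : ℝ) 0 ×ˢ closedBall (0 : EuclideanSpace ℝ (Fin 3)) 1)) ≤ ENNReal.ofReal δ) →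
        ¬ IsBackwardSingularPoint u 0 := by
  intro C M hM
  obtain ⟨L, hL, δ, hδ, hfast⟩ := stub_frFastRecurrenceRemoval C M hM
  refine ⟨L, hL, δ, hδ, fun u p G hsw hwg hI hdec hret => hfast u p G hsw hwg hI hdec fun a => ?_⟩
  obtain ⟨σ, hσ, hσret⟩ := hret a
  refine ⟨σ, hσ, le_trans ?_ hσret⟩
  exact eLpNorm_mono_measure _ (Measure.restrict_mono parabolicCylinder_one_zero_subset le_rfl)

/-- **Portrait clause: a Type-I singularity model recurs SLOWLY.**  For every rate `C` and bound
`M < ⊤` there are `L > 0`, `δ > 0` such that every origin-singular class member has a log-scale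
window `[a, a + L]` during which its scaling orbit stays `δ`-FAR from it in `L³(Q(0,1))` (the
contrapositive of fast recurrence removal; with `orbit never rests`, p142905, the two-sided picture:
the orbit of a counterexample neither slows down nor returns fast). [cite: AlbrittonBarker2019, Prop. 2.3] -/
theorem fr_slowRecurrence_of_singular :
    ∀ (C : ℝ) (M : ℝ≥0∞), M < ⊤ → ∃ L : ℝ, 0 < L ∧ ∃ δ : ℝ, 0 < δ ∧
      ∀ (u : ℝ → EuclideanSpace ℝ (Fin 3) → EuclideanSpace ℝ (Fin 3))
        (p : ℝ → EuclideanSpace ℝ (Fin 3) → ℝ)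
        (G : ℝ → EuclideanSpace ℝ (Fin 3) → EuclideanSpace ℝ (Fin 3) →L[ℝ] EuclideanSpace ℝ (Fin 3)),
        IsSuitableWeakSolutionOn (slab (EuclideanSpace ℝ (Fin 3)) (Iio 0) isOpen_Iio) 1 0 u p →
        HasWeakSpatialGradientOn (slab (EuclideanSpace ℝ (Fin 3)) (Iio 0) isOpen_Iio) u G →
        typeIBound (Iio (0 : ℝ) ×ˢ univ) u p G ≤ M →
        HasTypeITimeDecay C u →
        IsBackwardSingularPoint u 0 →
        ∃ a : ℝ, ∀ σ ∈ Icc a (a + L),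
          ENNReal.ofReal δ <
            eLpNorm (uncurry (nsRescale (Real.exp σ) u) - uncurry u) 3
              (volume.restrict (parabolicCylinder 1 (0 : ℝ × EuclideanSpace ℝ (Fin 3)))) := by
  intro C M hM
  obtain ⟨L, hL, δ, hδ, hfast⟩ := stub_frFastRecurrenceRemoval C M hM
  refine ⟨L, hL, δ, hδ, fun u p G hsw hwg hI hdec hsing => ?_⟩
  by_contra h
  push Not at h
  exact hfast u p G hsw hwg hI hdec h hsing

end Summit.NavierStokesRegularity.NavierStokesRegularity.Theorems

end
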